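import Summits.AtomisticToContinuum.Crystallization.Theorems.FrustratedLawDichotomyStrainedPatchHomValueT2SoundZ

/-!
# (I1) slope part A — the `y`-SPACE FORCE TABLES of `…HomValueT2Track` §14b enclose the real data (critic row 1674 (B) (I1) docket item 3 `slopeT2_sound`,
# first instalment; 27623 `(H) HomFloor`, hcp half; decomp-a2c hand-1 g49)

Per label with argument `q` and linear part `V` (`y = Vq`, `ρ = ‖y‖`, `β = W′(ρ)/ρ`, `α = (W″(ρ) − W′(ρ)/ρ)/ρ²`, folded coordinates `k < 9`):
* `mem_dF`: `dF R a k ∋ α ζ_k y_a + β (∂_k y)_a`;  `mem_ddF`: `ddF R a k l ∋ P_kl y_a + α(ζ_k(∂_l y)_a + ζ_l(∂_k y)_a) + β(∂_k∂_l y)_a`;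
  `mem_jF`: the graph-combined entry `jF aP R a e ∋ F_e + Σ_m F_{6+m} A_me` — pure interval bookkeeping on top of `mem_mkDRec`;
* ★ `hasDerivAt_force_label`: along the joint path `t ↦ (V + tΔU)(q + tΔξ)`, off the junction radii, the force component `β(ρ_t) y_a(t)` has derivative
  `Σ_k (α ζ_k y_a + β (∂_k y)_a)(s) δ_k` — the real counterpart of `dF`; ★★ `hasDerivAt_dforce_label`: inside one regime the force Jacobian entry
  has derivative `Σ_m ddF^ℝ_{km} δ_m` — the real counterpart of `ddF`;
* §3 the two 1-D two-sided enclosures the slope assembly integrates with: first order off a finite set (`abs_sub_le_of_deriv_off`, junction class) and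
  second order (`abs_sub_sub_le_of_deriv2_off`, Lipschitz class).

No definitions; 0 sorry; standard axioms; no instances / notation / `#eval`.  `--supports stmt-AtomisticToContinuum-27623`.
-/

noncomputable section

namespace Summit.AtomisticToContinuum.Crystallization.Theorems.FrustratedLawDichotomyStrainedPatchHomValueT2Kit

open scoped BigOperators RealInnerProductSpace
open Finset
open Literature.Analysis.ValidatedNumerics.Numerics
open Summit.AtomisticToContinuum.Crystallization.Theorems.ChargedEnergyGapNegative (E3)
open Summit.AtomisticToContinuum.Crystallization.Theorems.FrustratedLawDichotomySchurCut (effPot w₄₅ ω₄)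
open Summit.AtomisticToContinuum.Crystallization.Theorems.FrustratedLawDichotomyStrainedPatchTaylorLeaves (junctions)
open Summit.AtomisticToContinuum.Crystallization.Theorems.FrustratedLawDichotomyStrainedPatchTaylorRegular (differentiableAt_deriv_Wrec)
open Summit.AtomisticToContinuum.Crystallization.Theorems.FrustratedLawDichotomyStrainedPatchHomConvexSegment (monotoneOn_of_deriv_nonneg_off)

/-! ## §1. Interval bookkeeping: `dF`, `ddF`, `jF` enclose the real force data -/

/-- `dF R a k ∋ α ζ_k y_a + β (∂_k y)_a` for a dispatched record and coefficient members `α, β`. [formal bookkeeping] -/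
theorem mem_dF {top : ℕ} (htop : top ≤ 9) {E : Fin 3 × Fin 3 → FI} {qI : Fin 3 → FI} {R : DRec} (h : mkDRec top E qI = some R)
    (V : E3 →L[ℝ] E3) (q : E3) (hE : ∀ ab : Fin 3 × Fin 3, FI.mem ((V (EuclideanSpace.single ab.2 (1 : ℝ))) ab.1) (E ab))
    (hq : ∀ c, FI.mem (q c) (qI c)) {α β : ℝ} (hα : FI.mem α R.co.al) (hβ : FI.mem β R.co.be) (a : Fin 3) {k : ℕ} (hk : k < top) :
    FI.mem (α * (zetaN V q k * (V q) a) + β * dyR V q k a) (dF R a k) := by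
  obtain ⟨hy, hd, hz, _⟩ := mem_mkDRec htop h V q hE hq
  unfold dF
  exact FI.mem_add (FI.mem_mul hα (FI.mem_mul (hz k hk) (hy a))) (FI.mem_mul hβ (hd k hk a))

/-- `ddF R a k l ∋ P_kl y_a + α (ζ_k (∂_l y)_a + ζ_l (∂_k y)_a) + β (∂_k∂_l y)_a` (`P_kl` any member of the record's `pt` entry). [formal bookkeeping] -/
theorem mem_ddF {top : ℕ} (htop : top ≤ 9) {E : Fin 3 × Fin 3 → FI} {qI : Fin 3 → FI} {R : DRec} (h : mkDRec top E qI = some R)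
    (V : E3 →L[ℝ] E3) (q : E3) (hE : ∀ ab : Fin 3 × Fin 3, FI.mem ((V (EuclideanSpace.single ab.2 (1 : ℝ))) ab.1) (E ab))
    (hq : ∀ c, FI.mem (q c) (qI c)) {α β P : ℝ} (hα : FI.mem α R.co.al) (hβ : FI.mem β R.co.be) (a : Fin 3) {k l : ℕ} (hk : k < top)
    (hl : l < top) (hP : FI.mem P (R.pt.getD (sIx k l) fi0)) :
    FI.mem (P * (V q) a + α * (zetaN V q k * dyR V q l a + zetaN V q l * dyR V q k a) + β * ddyR k l a) (ddF R a k l) := by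
  obtain ⟨hy, hd, hz, _⟩ := mem_mkDRec htop h V q hE hq
  have hk9 : k < 9 := by omega
  have hl9 : l < 9 := by omega
  unfold ddF
  rw [← d2_cast hk9 hl9 a]
  exact FI.mem_add (FI.mem_add (FI.mem_mul hP (hy a))
    (FI.mem_mul hα (FI.mem_add (FI.mem_mul (hz k hk) (hd l hl a)) (FI.mem_mul (hz l hl) (hd k hk a))))) (FI.mem_mulInt hβ (d2 k l a))

/-- `jF aP R a e ∋ F_e + F_6 A_0e + F_7 A_1e + F_8 A_2e` for members `F_k ∈ dF R a k`. [formal bookkeeping] -/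
theorem mem_jF (aP : Fin 3 → Fin 6 → ℤ) (R : DRec) (a : Fin 3) (F : ℕ → ℝ) (hF : ∀ k, k < 9 → FI.mem (F k) (dF R a k)) {e : ℕ} (he : e < 6) :
    FI.mem (F e + F 6 * (((aP ⟨0, by norm_num⟩ ⟨e, he⟩ : ℤ) : ℝ) / SC) + F 7 * (((aP ⟨1, by norm_num⟩ ⟨e, he⟩ : ℤ) : ℝ) / SC) +
      F 8 * (((aP ⟨2, by norm_num⟩ ⟨e, he⟩ : ℤ) : ℝ) / SC)) (jF aP R a e) := by
  have h := FI.mem_add (FI.mem_add (FI.mem_add (hF e (by omega)) (FI.mem_mul (hF 6 (by norm_num)) (mem_aFI aP (m := 0) (by norm_num) he)))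
    (FI.mem_mul (hF 7 (by norm_num)) (mem_aFI aP (m := 1) (by norm_num) he))) (FI.mem_mul (hF 8 (by norm_num)) (mem_aFI aP (m := 2) (by norm_num) he))
  unfold jF
  simpa [List.range, List.range.loop, List.foldl] using h

/-! ## §2. ★ The force component along the joint path -/

/-- ★ **FIRST DERIVATIVE OF ONE LABEL'S `y`-SPACE FORCE COMPONENT** along the path, off the junction radii:
`(β(ρ_t) y_a(t))′(s) = Σ_k (α ζ_k y_a + β (∂_k y)_a)(s) δ_k` (symmetric `ΔU`). [folklore chaining: quotient rule for `β = W′/ρ`, `ρ′ = ⟪y, y′⟫/ρ`,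
`…SoundI.inner_y_dy_eq_sum`, `…SoundJ.dy_apply_eq_sum`] -/
theorem hasDerivAt_force_label (V ΔU : E3 →L[ℝ] E3) (q Δξ : E3) (hsym : ∀ a b : Fin 3, ent ΔU a b = ent ΔU b a) {s : ℝ}
    (h0 : 0 < ‖(V + s • ΔU) (q + s • Δξ)‖) (hJ : ‖(V + s • ΔU) (q + s • Δξ)‖ ∉ junctions) (a : Fin 3) :
    HasDerivAt (fun t : ℝ => deriv (effPot w₄₅ ω₄ (3 / 400)) ‖(V + t • ΔU) (q + t • Δξ)‖ / ‖(V + t • ΔU) (q + t • Δξ)‖ * ((V + t • ΔU) (q + t • Δξ)) a)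
      (∑ k ∈ range 9, ((deriv (deriv (effPot w₄₅ ω₄ (3 / 400))) ‖(V + s • ΔU) (q + s • Δξ)‖ - deriv (effPot w₄₅ ω₄ (3 / 400)) ‖(V + s • ΔU) (q + s • Δξ)‖ / ‖(V + s • ΔU) (q + s • Δξ)‖) / ‖(V + s • ΔU) (q + s • Δξ)‖ ^ 2 * (zetaN (V + s • ΔU) (q + s • Δξ) k * ((V + s • ΔU) (q + s • Δξ)) a) + deriv (effPot w₄₅ ω₄ (3 / 400)) ‖(V + s • ΔU) (q + s • Δξ)‖ / ‖(V + s • ΔU) (q + s • Δξ)‖ * dyR (V + s • ΔU) (q + s • Δξ) k a) * dispN ΔU Δξ k) s := by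
  have hne : ‖(V + s • ΔU) (q + s • Δξ)‖ ≠ 0 := h0.ne'
  have hy0 : (V + s • ΔU) (q + s • Δξ) ≠ 0 := norm_ne_zero_iff.1 hne
  have hW : HasDerivAt (deriv (effPot w₄₅ ω₄ (3 / 400))) (deriv (deriv (effPot w₄₅ ω₄ (3 / 400))) ‖(V + s • ΔU) (q + s • Δξ)‖) ‖(V + s • ΔU) (q + s • Δξ)‖ := (differentiableAt_deriv_Wrec h0 hJ).hasDerivAt
  have hβ : HasDerivAt (fun r => deriv (effPot w₄₅ ω₄ (3 / 400)) r / r) ((deriv (deriv (effPot w₄₅ ω₄ (3 / 400))) ‖(V + s • ΔU) (q + s • Δξ)‖ * ‖(V + s • ΔU) (q + s • Δξ)‖ - deriv (effPot w₄₅ ω₄ (3 / 400)) ‖(V + s • ΔU) (q + s • Δξ)‖ * 1) / ‖(V + s • ΔU) (q + s • Δξ)‖ ^ 2) ‖(V + s • ΔU) (q + s • Δξ)‖ :=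
    hW.div (hasDerivAt_id ‖(V + s • ΔU) (q + s • Δξ)‖) hne
  have hβpath := hβ.comp s (hasDerivAt_norm_path (hasDerivAt_labelPath V ΔU q Δξ s) hy0)
  have h := hβpath.mul (hasDerivAt_apply_path V ΔU q Δξ a s)
  refine h.congr_deriv ?_
  simp only [Function.comp_apply]
  rw [inner_y_dy_eq_sum (V + s • ΔU) ΔU hsym (q + s • Δξ) Δξ, dy_apply_eq_sum (V + s • ΔU) ΔU hsym (q + s • Δξ) Δξ a]
  have e : ∑ k ∈ range 9, ((deriv (deriv (effPot w₄₅ ω₄ (3 / 400))) ‖(V + s • ΔU) (q + s • Δξ)‖ - deriv (effPot w₄₅ ω₄ (3 / 400)) ‖(V + s • ΔU) (q + s • Δξ)‖ / ‖(V + s • ΔU) (q + s • Δξ)‖) / ‖(V + s • ΔU) (q + s • Δξ)‖ ^ 2 * (zetaN (V + s • ΔU) (q + s • Δξ) k * ((V + s • ΔU) (q + s • Δξ)) a) + deriv (effPot w₄₅ ω₄ (3 / 400)) ‖(V + s • ΔU) (q + s • Δξ)‖ / ‖(V + s • ΔU) (q + s • Δξ)‖ * dyR (V + s • ΔU) (q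 + s • Δξ) k a) * dispN ΔU Δξ k =
      (deriv (deriv (effPot w₄₅ ω₄ (3 / 400))) ‖(V + s • ΔU) (q + s • Δξ)‖ - deriv (effPot w₄₅ ω₄ (3 / 400)) ‖(V + s • ΔU) (q + s • Δξ)‖ / ‖(V + s • ΔU) (q + s • Δξ)‖) / ‖(V + s • ΔU) (q + s • Δξ)‖ ^ 2 * ((V + s • ΔU) (q + s • Δξ)) a * ∑ k ∈ range 9, zetaN (V + s • ΔU) (q + s • Δξ) k * dispN ΔU Δξ k + deriv (effPot w₄₅ ω₄ (3 / 400)) ‖(V + s • ΔU) (q + s • Δξ)‖ / ‖(V + s • ΔU) (q + s • Δξ)‖ * ∑ k ∈ range 9, dyR (V + s • ΔU) (q + s • Δξ) k a * dispN ΔU Δξ k := by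
    rw [Finset.mul_sum, Finset.mul_sum, ← Finset.sum_add_distrib]
    exact Finset.sum_congr rfl fun k _ => by ring
  rw [e]
  field_simp

/-- ★★ **THE FORCE JACOBIAN ENTRY ALONG THE PATH, inside one open regime**: given the derivative chain of the true coefficients at `ρ_s`
(`HasDerivAt α (a₁ρ_s) ρ_s`, `HasDerivAt β (α(ρ_s)ρ_s) ρ_s`, as supplied by `…SoundN.coefL_lip`), the entry `α ζ_k y_a + β (∂_k y)_a` is differentiable at
`s` with derivative `Σ_m ((a₁ζ_kζ_m + αν_km) y_a + α(ζ_k(∂_m y)_a + ζ_m(∂_k y)_a) + β(∂_k∂_m y)_a) δ_m` — the real expression enclosed by `mem_ddF`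
(`l = m`, `P = a₁ζ_kζ_m + αν_km` from `…SoundN.mem_pt_rt`). [folklore: chain + product rules, `…SoundP` §3] -/
theorem hasDerivAt_dforce_label (V ΔU : E3 →L[ℝ] E3) (q Δξ : E3) (hsym : ∀ a b : Fin 3, ent ΔU a b = ent ΔU b a) {k : ℕ} (hk : k < 9)
    {s : ℝ} (h0 : 0 < ‖(V + s • ΔU) (q + s • Δξ)‖) {a₁ : ℝ}
    (hα : HasDerivAt (fun r => (deriv (deriv (effPot w₄₅ ω₄ (3 / 400))) r - deriv (effPot w₄₅ ω₄ (3 / 400)) r / r) / r ^ 2) (a₁ * ‖(V + s • ΔU) (q + s • Δξ)‖) ‖(V + s • ΔU) (q + s • Δξ)‖)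
    (hβ : HasDerivAt (fun r => deriv (effPot w₄₅ ω₄ (3 / 400)) r / r) ((deriv (deriv (effPot w₄₅ ω₄ (3 / 400))) ‖(V + s • ΔU) (q + s • Δξ)‖ - deriv (effPot w₄₅ ω₄ (3 / 400)) ‖(V + s • ΔU) (q + s • Δξ)‖ / ‖(V + s • ΔU) (q + s • Δξ)‖) / ‖(V + s • ΔU) (q + s • Δξ)‖ ^ 2 * ‖(V + s • ΔU) (q + s • Δξ)‖) ‖(V + s • ΔU) (q + s • Δξ)‖) (a : Fin 3) :
    HasDerivAt (fun t : ℝ => (deriv (deriv (effPot w₄₅ ω₄ (3 / 400))) ‖(V + t • ΔU) (q + t • Δξ)‖ - deriv (effPot w₄₅ ω₄ (3 / 400)) ‖(V + t • ΔU) (q + t • Δξ)‖ / ‖(V + t • ΔU) (q + t • Δξ)‖) / ‖(V + t • ΔU) (q + t • Δξ)‖ ^ 2 * (zetaN (V + t • ΔU) (q + t • Δξ) k * ((V + t • ΔU) (q + t • Δξ)) a) + deriv (effPot w₄₅ ω₄ (3 / 400)) ‖(V + t • ΔU) (q + t • Δξ)‖ / ‖(V + t • ΔU) (q + t • Δξ)‖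 * dyR (V + t • ΔU) (q + t • Δξ) k a)
      (∑ m ∈ range 9, ((a₁ * (zetaN (V + s • ΔU) (q + s • Δξ) k * zetaN (V + s • ΔU) (q + s • Δξ) m) + (deriv (deriv (effPot w₄₅ ω₄ (3 / 400))) ‖(V + s • ΔU) (q + s • Δξ)‖ - deriv (effPot w₄₅ ω₄ (3 / 400)) ‖(V + s • ΔU) (q + s • Δξ)‖ / ‖(V + s • ΔU) (q + s • Δξ)‖) / ‖(V + s • ΔU) (q + s • Δξ)‖ ^ 2 * nuR (V + s • ΔU) (q + s • Δξ) k m) * ((V + s • ΔU) (q + s • Δξ)) a +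
          (deriv (deriv (effPot w₄₅ ω₄ (3 / 400))) ‖(V + s • ΔU) (q + s • Δξ)‖ - deriv (effPot w₄₅ ω₄ (3 / 400)) ‖(V + s • ΔU) (q + s • Δξ)‖ / ‖(V + s • ΔU) (q + s • Δξ)‖) / ‖(V + s • ΔU) (q + s • Δξ)‖ ^ 2 * (zetaN (V + s • ΔU) (q + s • Δξ) k * dyR (V + s • ΔU) (q + s • Δξ) m a + zetaN (V + s • ΔU) (q + s • Δξ) m * dyR (V + s • ΔU) (q + s • Δξ) k a) + deriv (effPot w₄₅ ω₄ (3 / 400)) ‖(V + s • ΔU) (q + s • Δξ)‖ / ‖(V + s • ΔU) (q + s • Δξ)‖ * ddyR k m a) * dispN ΔU Δξ m) s := by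
  have hne : ‖(V + s • ΔU) (q + s • Δξ)‖ ≠ 0 := h0.ne'
  have hy0 : (V + s • ΔU) (q + s • Δξ) ≠ 0 := norm_ne_zero_iff.1 hne
  have hρ := hasDerivAt_rho_label (V := V) (ΔU := ΔU) (q := q) (Δξ := Δξ) hsym hy0
  have hαt := hα.comp s hρ
  have hβt := hβ.comp s hρ
  have hζk := hasDerivAt_zetaN_path V ΔU q Δξ hsym hk s
  have hya := hasDerivAt_apply_path V ΔU q Δξ a s
  have hd := hasDerivAt_dyR_path (V := V) (ΔU := ΔU) (q := q) (Δξ := Δξ) hsym hk a s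
  have h := (hαt.mul (hζk.mul hya)).add (hβt.mul hd)
  refine h.congr_deriv ?_
  simp only [Function.comp_apply, Pi.mul_apply]
  rw [dy_apply_eq_sum (V + s • ΔU) ΔU hsym (q + s • Δξ) Δξ a]
  have e : ∑ m ∈ range 9, ((a₁ * (zetaN (V + s • ΔU) (q + s • Δξ) k * zetaN (V + s • ΔU) (q + s • Δξ) m) + (deriv (deriv (effPot w₄₅ ω₄ (3 / 400))) ‖(V + s • ΔU) (q + s • Δξ)‖ - deriv (effPot w₄₅ ω₄ (3 / 400)) ‖(V + s • ΔU) (q + s • Δξ)‖ / ‖(V + s • ΔU) (q + s • Δξ)‖) / ‖(V + s • ΔU) (q + s • Δξ)‖ ^ 2 * nuR (V + s • ΔU) (q + s • Δξ) k m) * ((V + s • ΔU) (q + s • Δξ)) a +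
          (deriv (deriv (effPot w₄₅ ω₄ (3 / 400))) ‖(V + s • ΔU) (q + s • Δξ)‖ - deriv (effPot w₄₅ ω₄ (3 / 400)) ‖(V + s • ΔU) (q + s • Δξ)‖ / ‖(V + s • ΔU) (q + s • Δξ)‖) / ‖(V + s • ΔU) (q + s • Δξ)‖ ^ 2 * (zetaN (V + s • ΔU) (q + s • Δξ) k * dyR (V + s • ΔU) (q + s • Δξ) m a + zetaN (V + s • ΔU) (q + s • Δξ) m * dyR (V + s • ΔU) (q + s • Δξ) k a) + deriv (effPot w₄₅ ω₄ (3 / 400)) ‖(V + s • ΔU) (q + s • Δξ)‖ / ‖(V + s • ΔU) (q + s • Δξ)‖ * ddyR k m a) * dispN ΔU Δξ m =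
      a₁ * (∑ m ∈ range 9, zetaN (V + s • ΔU) (q + s • Δξ) m * dispN ΔU Δξ m) * (zetaN (V + s • ΔU) (q + s • Δξ) k * ((V + s • ΔU) (q + s • Δξ)) a) +
        (deriv (deriv (effPot w₄₅ ω₄ (3 / 400))) ‖(V + s • ΔU) (q + s • Δξ)‖ - deriv (effPot w₄₅ ω₄ (3 / 400)) ‖(V + s • ΔU) (q + s • Δξ)‖ / ‖(V + s • ΔU) (q + s • Δξ)‖) / ‖(V + s • ΔU) (q + s • Δξ)‖ ^ 2 * ((∑ m ∈ range 9, nuR (V + s • ΔU) (q + s • Δξ) k m * dispN ΔU Δξ m) * ((V + s • ΔU) (q + s • Δξ)) a + zetaN (V + s • ΔU) (q + s • Δξ) k * ∑ m ∈ range 9, dyR (V + s • ΔU) (q + s • Δξ) m a * dispN ΔU Δξ m) +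
        ((deriv (deriv (effPot w₄₅ ω₄ (3 / 400))) ‖(V + s • ΔU) (q + s • Δξ)‖ - deriv (effPot w₄₅ ω₄ (3 / 400)) ‖(V + s • ΔU) (q + s • Δξ)‖ / ‖(V + s • ΔU) (q + s • Δξ)‖) / ‖(V + s • ΔU) (q + s • Δξ)‖ ^ 2 * (∑ m ∈ range 9, zetaN (V + s • ΔU) (q + s • Δξ) m * dispN ΔU Δξ m) * dyR (V + s • ΔU) (q + s • Δξ) k a + deriv (effPot w₄₅ ω₄ (3 / 400)) ‖(V + s • ΔU) (q + s • Δξ)‖ / ‖(V + s • ΔU) (q + s • Δξ)‖ * ∑ m ∈ range 9, ddyR k m a * dispN ΔU Δξ m) := by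
    simp only [Finset.mul_sum, Finset.sum_mul, ← Finset.sum_add_distrib]
    exact Finset.sum_congr rfl fun m _ => by ring
  rw [e]
  field_simp

/-! ## §3. One-dimensional two-sided enclosures along a segment (first order off a finite set; second order) -/

/-- ★ **FIRST-ORDER ENCLOSURE OFF A FINITE SET** (the junction-class labels): `g` continuous on `[0,1]`, `HasDerivAt g (g′ t) t` and `|g′ t| ≤ M` at
every `t ∈ (0,1) ∖ X` ⟹ `|g 1 − g 0| ≤ M`. [folklore: `M t ∓ g t` are monotone, `…HomConvexSegment.monotoneOn_of_deriv_nonneg_off`] -/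
theorem abs_sub_le_of_deriv_off {g g' : ℝ → ℝ} {M : ℝ} (X : Finset ℝ) (hgc : ContinuousOn g (Set.Icc (0 : ℝ) 1))
    (hg : ∀ t ∈ Set.Ioo (0 : ℝ) 1, t ∉ X → HasDerivAt g (g' t) t) (hM : ∀ t ∈ Set.Ioo (0 : ℝ) 1, t ∉ X → |g' t| ≤ M) :
    |g 1 - g 0| ≤ M := by
  have hl : ContinuousOn (fun t : ℝ => M * t) (Set.Icc (0 : ℝ) 1) := by fun_prop
  have h1 := monotoneOn_of_deriv_nonneg_off (h := fun t => M * t - g t) (h' := fun t => M - g' t) (x := 0) (y := 1) X (hl.sub hgc)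
    (fun t ht hX => (((hasDerivAt_id t).const_mul M).sub (hg t ht hX)).congr_deriv (by simp))
    (fun t ht hX => by have := (abs_le.1 (hM t ht hX)).2; show 0 ≤ M - g' t; linarith) 0 1 le_rfl le_rfl zero_le_one
  have h2 := monotoneOn_of_deriv_nonneg_off (h := fun t => M * t + g t) (h' := fun t => M + g' t) (x := 0) (y := 1) X (hl.add hgc)
    (fun t ht hX => (((hasDerivAt_id t).const_mul M).add (hg t ht hX)).congr_deriv (by simp))
    (fun t ht hX => by have := (abs_le.1 (hM t ht hX)).1; show 0 ≤ M + g' t; linarith) 0 1 le_rfl le_rfl zero_le_one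
  simp only [mul_zero, mul_one, zero_sub, zero_add] at h1 h2
  rw [abs_le]; constructor <;> linarith

/-- ★ **SECOND-ORDER TWO-SIDED ENCLOSURE** (the Lipschitz-class labels): `HasDerivAt g (g′ t) t` on `[0,1]`, `g′` continuous there, `HasDerivAt g′ (g″ t) t`
and `|g″ t| ≤ M` at every `t ∈ (0,1) ∖ X` ⟹ `|g 1 − g 0 − g′ 0| ≤ M/2`. [folklore: `…SoundE.expansion_floor` for `g` and `−g`] -/
theorem abs_sub_sub_le_of_deriv2_off {g g' g'' : ℝ → ℝ} {M : ℝ} (X : Finset ℝ) (hg : ∀ t ∈ Set.Icc (0 : ℝ) 1, HasDerivAt g (g' t) t)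
    (hg'c : ContinuousOn g' (Set.Icc (0 : ℝ) 1)) (hg'' : ∀ t ∈ Set.Ioo (0 : ℝ) 1, t ∉ X → HasDerivAt g' (g'' t) t)
    (hM : ∀ t ∈ Set.Ioo (0 : ℝ) 1, t ∉ X → |g'' t| ≤ M) : |g 1 - g 0 - g' 0| ≤ M / 2 := by
  have h1 : g 0 + g' 0 + -M / 2 ≤ g 1 :=
    expansion_floor X hg hg'c hg'' fun t ht hX => by have := (abs_le.1 (hM t ht hX)).1; linarith
  have h2 : -g 0 + -g' 0 + -M / 2 ≤ -g 1 :=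
    expansion_floor X (g := fun t => -g t) (g' := fun t => -g' t) (g'' := fun t => -g'' t) (fun t ht => (hg t ht).neg) hg'c.neg
      (fun t ht hX => (hg'' t ht hX).neg) fun t ht hX => by have := (abs_le.1 (hM t ht hX)).2; linarith
  rw [abs_le]; constructor <;> linarith

end Summit.AtomisticToContinuum.Crystallization.Theorems.FrustratedLawDichotomyStrainedPatchHomValueT2Kit
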